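import Literature.AnabelianGeometry.EtaleTheta.FrobenioidThetaBiKummer

/-!
# [EtTh] §5 p.331 / Prop. 5.2 (ii), (iii) p.324 (PDF pp.105, 98): instance forms of `StrvSection`, `ThetaPairActionsAgree`, `ThetaPairKummerClass` at the PRINTED hypotheses

Mochizuki, *The étale theta function and its Frobenioid-theoretic manifestations*, Publ. RIMS **45**
(2009) [cite: MochizukiEtTh2009, Prop 5.2 p.324 (PDF p.98)].  abc-iut cell, block F (fact-proving wave,
batch 2), seat abc-iut-f-126, tranche 126 = FACT-LIST rows **F-0555** `ThetaFrobenioid.StrvSection` (§5 p.331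
(PDF p.105): `s^trv_N` "aris[es] from a base-Frobenius pair of `A_N`", i.e. is a section), **F-0556**
`FrobenioidThetaBiKummer.ThetaPairActionsAgree` (Prop. 5.2 (ii)), **F-0558**
`FrobenioidThetaBiKummer.ThetaPairKummerClass` (Prop. 5.2 (iii)).  PROOF-ONLY companion of abc-iut-L2-t4's
FROZEN `FrobenioidThetaBiKummer.lean` (imported, never edited or restated; no `def`, no instance, no notation).

STATUS OF THE ROWS.  All three are PARAMETRISED predicates on abstract §5 data `𝔉 : ThetaFrobenioid C D` (a
DATA-ONLY interface).  Their universal closures are REFUTED and toy instance forms PROVED in abc-iut-w6-d043's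
`Discharge/Sec5BiKummerSchemaVerdicts.lean` (`SchemaToy.not_forall_strvSection`, `not_forall_thetaPairActionsAgree`,
`not_forall_thetaPairKummerClass`; `…_toyC`); FACT-LIST rule R5: such rows are consumed AT NAMED INSTANCES.
This file adds the ABSTRACT instance forms — valid for EVERY §5 datum under the printed hypotheses — that
say exactly what each row reduces to:

* **F-0556 (Prop. 5.2 (ii))** "the group actions of Proposition 1.1, (ii); Lemma 1.2 … are precisely the
  actions determined by the bi-Kummer `l·N`-th root [cf. Proposition 4.3, (i)]": by the UNIQUENESS clause of
  Prop. 4.3 (i) / p.331 ("determines unique group homomorphisms"; abc-iut-L2-t4's `sgpUnique_of`, from total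
  epimorphicity [FrdI] Def. 1.3), ANY pair of actions `H_{B_N} → Aut_C(B_N)` satisfying the two printed
  defining relations over the epimorphisms `s^⊓_N`, `s^⊔_N` IS `(s^⊓-gp_N|_{H_{B_N}}, s^⊔-gp_N)`:
  `thetaPairActionsAgree_of_definingRelations`; with the converse, `thetaPairActionsAgree_iff_definingRelations`
  — the row holds for the supplied §1 actions IFF they satisfy the defining relations (the content to be
  delivered by the §1 decls, `TODO-merge(abc-iut-L2-t1)` in the typed statement).
* **F-0558 (Prop. 5.2 (iii))**: for EVERY comparison `ν : (l·Δ_Θ)_{B_N} ⊗ ℤ/Nℤ ⥲ μ_N(B_N)`,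
  `(∃ η, ThetaPairKummerClass 𝔉 η ν) ↔ BiKummerDifferenceMem 𝔉` (`exists_thetaPairKummerClass_iff`; `→` is
  abc-iut-L2-t11's `biKummerDifferenceMem_of_thetaPairKummerClass` of `Discharge/Sec5RigidityGlue.lean`, re-proved
  inline to keep the imports at the trunk file; `←` is the tautological cocycle `η := ν⁻¹ ∘ (s^⊓-gp_N · (s^⊔-gp_N)⁻¹)`,
  `thetaPairKummerClass_of_biKummerDifferenceMem`, witness `u := 1`) — i.e. the `η`-EXISTENTIAL content of the
  typed row is exactly Prop. 4.3 (iii) (FACT row F-0551); the remaining content of Prop. 5.2 (iii) is the PIN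
  of `η` to "the reduction modulo `N` of the class `η̲̈^Θ`", which the typed predicate receives as a parameter
  (typed elsewhere: `EtaTautological`, F-0521 `ThetaSectionCompat`, `Discharge/Sec5ThetaSectionCompatOfKummerClass.lean`).
  Also: the pointwise criterion `thetaPairKummerClass_of_forall_eq` (`u := 1`) and, when `H_{B_N}` centralises
  `μ_N(B_N)` through `s^⊓-gp_N`, the coboundary term vanishes: `thetaPairKummerClass_iff_forall_eq_of_comm`.
* **F-0555 (`s^trv_N` is a section)** — structural consequences for every datum satisfying it: `s^trv_N` is a
  right inverse of `Aut_C(A_N) → Aut_D(A_N^bs)` (`strvSection_iff_rightInverse`), so `A_N` is Aut-ample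
  ([FrdI] Def. 1.2 (iv); `isAutAmple_AN_of_strvSection`), `s^trv_N` is injective, meets `O^×(A_N)` trivially and
  `Aut_C(A_N) = O^×(A_N) · s^trv_N(Aut_D(A_N^bs))` (`units_sup_range_strv_eq_top`) — the split form of the exact
  sequence `1 → O^×(A_N) → Aut_C(A_N) → Aut_D(A_N^bs) → 1` of Rmk. 5.12.5 (iii) (abc-iut-L2-t4's PROVED
  `units_eq_ker`).

HONEST FRAMING: kernel-checked implications between the cell's typed statements about abstract §5 data;
nothing of [EtTh] (a refereed paper) is asserted unconditionally; the genuine instances are the L2 discharge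
files cited above; nothing here bears on [IUTchIII] Cor. 3.12; no side is taken; typed ≠ proved; a FACT row
is an assumption label, not an endorsement.
-/

namespace Literature.AnabelianGeometry.EtaleTheta

open CategoryTheory

universe w v v' u u'

namespace ThetaFrobenioid

variable {C : Type u} [Category.{v} C] {D : Type u'} [Category.{v'} D] (𝔉 : ThetaFrobenioid.{w} C D)

/-! ### F-0555 `StrvSection`: `s^trv_N` splits `Aut_C(A_N) → Aut_D(A_N^bs)` -/

/-- `StrvSection` says literally that `s^trv_N` is a right inverse of `β ↦ β^bs` on `A_N` ("arising from
a base-Frobenius pair of `A_N`", [FrdI] Def. 2.7 (iii), Prop. 5.6).  FACT-LIST F-0555.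
[cite: MochizukiEtTh2009, §5 p.331 (PDF p.105)] -/
theorem strvSection_iff_rightInverse :
    𝔉.StrvSection ↔ Function.RightInverse 𝔉.strv (𝔉.autBase 𝔉.AN) :=
  Iff.rfl

/-- `StrvSection` as an identity of homomorphisms: `(−)^bs ∘ s^trv_N = id` on `Aut_D(A_N^bs)`.  F-0555.
[cite: MochizukiEtTh2009, §5 p.331 (PDF p.105)] -/
theorem strvSection_iff_comp_eq_id :
    𝔉.StrvSection ↔ (𝔉.autBase 𝔉.AN).comp 𝔉.strv = MonoidHom.id _ :=
  ⟨fun h => MonoidHom.ext fun g => h g, fun h g => DFunLike.congr_fun h g⟩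

/-- Under F-0555, `Aut_C(A_N) → Aut_D(A_N^bs)` is surjective. [cite: MochizukiEtTh2009, §5 p.331 (PDF p.105)] -/
theorem autBase_AN_surjective_of_strvSection (h : 𝔉.StrvSection) :
    Function.Surjective (𝔉.autBase 𝔉.AN) :=
  Function.RightInverse.surjective h

/-- Under F-0555, `s^trv_N` is injective. [cite: MochizukiEtTh2009, §5 p.331 (PDF p.105)] -/
theorem strv_injective_of_strvSection (h : 𝔉.StrvSection) : Function.Injective 𝔉.strv :=
  Function.LeftInverse.injective h

/-- Under F-0555, **`A_N` is Aut-ample** ([FrdI] Def. 1.2 (iv): every automorphism of `A_N^bs` lifts to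
`Aut_C(A_N)`, namely to `s^trv_N` of it).  [cite: MochizukiEtTh2009, §5 p.330–331 (PDF pp.104–105)] -/
theorem isAutAmple_AN_of_strvSection (h : 𝔉.StrvSection) : 𝔉.IsAutAmple 𝔉.AN :=
  fun β => ⟨𝔉.strv β, h β⟩

/-- Under F-0555, `s^trv_N(g)` is a unit of `A_N` only for `g = 1` (`O^×(A_N) = Ker((−)^bs)`, abc-iut-L2-t4's
`units_eq_ker`).  [cite: MochizukiEtTh2009, §5 p.331 (PDF p.105)] -/
theorem strv_mem_units_iff_of_strvSection (h : 𝔉.StrvSection) (g : Aut (𝔉.base.obj 𝔉.AN)) :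
    𝔉.strv g ∈ 𝔉.units 𝔉.AN ↔ g = 1 := by
  rw [𝔉.units_eq_ker, MonoidHom.mem_ker, h g]

/-- Under F-0555, `s^trv_N(Aut_D(A_N^bs)) ∩ O^×(A_N) = 1`. [cite: MochizukiEtTh2009, §5 p.331 (PDF p.105)] -/
theorem range_strv_disjoint_units_of_strvSection (h : 𝔉.StrvSection) :
    Disjoint 𝔉.strv.range (𝔉.units 𝔉.AN) := by
  rw [Subgroup.disjoint_def]
  rintro _ ⟨g, rfl⟩ hu
  rw [(𝔉.strv_mem_units_iff_of_strvSection h g).mp hu, map_one]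

/-- Under F-0555, every `α ∈ Aut_C(A_N)` is a unit times `s^trv_N(α^bs)`: `α · s^trv_N(α^bs)⁻¹ ∈ O^×(A_N)`.
[cite: MochizukiEtTh2009, §5 p.331 (PDF p.105)] -/
theorem mul_strv_autBase_inv_mem_units_of_strvSection (h : 𝔉.StrvSection) (α : Aut 𝔉.AN) :
    α * (𝔉.strv (𝔉.autBase 𝔉.AN α))⁻¹ ∈ 𝔉.units 𝔉.AN := by
  rw [𝔉.units_eq_ker, MonoidHom.mem_ker, map_mul, map_inv, h, mul_inv_cancel]

/-- Under F-0555, **`Aut_C(A_N) = O^×(A_N) · s^trv_N(Aut_D(A_N^bs))`** — with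
`range_strv_disjoint_units_of_strvSection`, the split form of the exact sequence
`1 → O^×(A_N) → Aut_C(A_N) → Aut_D(A_N^bs) → 1` (Rmk. 5.12.5 (iii)).
[cite: MochizukiEtTh2009, Rmk 5.12.5 (iii) p.345 (PDF p.119)] -/
theorem units_sup_range_strv_eq_top_of_strvSection (h : 𝔉.StrvSection) :
    𝔉.units 𝔉.AN ⊔ 𝔉.strv.range = ⊤ := by
  rw [eq_top_iff]
  intro α _
  have hmem : α * (𝔉.strv (𝔉.autBase 𝔉.AN α))⁻¹ * 𝔉.strv (𝔉.autBase 𝔉.AN α) ∈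
      𝔉.units 𝔉.AN ⊔ 𝔉.strv.range :=
    Subgroup.mul_mem_sup (𝔉.mul_strv_autBase_inv_mem_units_of_strvSection h α)
      (MonoidHom.mem_range.mpr ⟨_, rfl⟩)
  rwa [inv_mul_cancel_right] at hmem

end ThetaFrobenioid

namespace FrobenioidThetaBiKummer

variable {C : Type u} [Category.{v} C] {D : Type u'} [Category.{v'} D] (𝔉 : ThetaFrobenioid.{w} C D)

/-! ### F-0556 `ThetaPairActionsAgree` (Prop. 5.2 (ii)) -/

/-- `ThetaPairActionsAgree` pointwise: the supplied §1 actions ARE `s^⊓-gp_N|_{H_{B_N}}` and `s^⊔-gp_N`,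
element by element.  FACT-LIST F-0556.  [cite: MochizukiEtTh2009, Prop 5.2 (ii) p.324 (PDF p.98)] -/
theorem thetaPairActionsAgree_iff (actS actT : 𝔉.HB →* Aut 𝔉.BN) :
    ThetaPairActionsAgree 𝔉 actS actT ↔
      (∀ h : 𝔉.HB, actS h = 𝔉.sgpCap (h : Aut (𝔉.base.obj 𝔉.BN))) ∧ ∀ h : 𝔉.HB, actT h = 𝔉.sgpCup h :=
  and_congr
    ⟨fun e h => by simpa only [MonoidHom.comp_apply, Subgroup.coe_subtype] using DFunLike.congr_fun e h,
      fun e => MonoidHom.ext fun h => by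
        simpa only [MonoidHom.comp_apply, Subgroup.coe_subtype] using e h⟩
    ⟨fun e h => DFunLike.congr_fun e h, fun e => MonoidHom.ext e⟩

/-- **Prop. 5.2 (ii) from the uniqueness clause of Prop. 4.3 (i)** (p.331 (PDF p.105) "determines unique group
homomorphisms"; print: the §1 actions are "precisely the actions determined by the bi-Kummer `l·N`-th root
[cf. Proposition 4.3, (i)]"): if `s^⊓_N`, `s^⊔_N` are epimorphisms ([FrdI] Def. 1.3: a Frobenioid is totally
epimorphic), `s^⊓-gp_N`, `s^⊔-gp_N` satisfy their printed defining relations (F-0552 `SgpCapSpec`, F-0553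
`SgpCupSpec`) and the supplied actions `actS`, `actT : H_{B_N} → Aut_C(B_N)` satisfy the SAME relations
(`actS(h) ∘ s^⊓_N = s^⊓_N ∘ s^trv_N(h)`, `actT(h) ∘ s^⊔_N = s^⊔_N ∘ s^trv_N(h)`), then `ThetaPairActionsAgree`
holds.  FACT-LIST F-0556, instance form at the printed hypotheses (every §5 datum).
[cite: MochizukiEtTh2009, Prop 5.2 (ii) p.324 (PDF p.98)] -/
theorem thetaPairActionsAgree_of_definingRelations [Epi 𝔉.sCap] [Epi 𝔉.sCup]
    (hcap : 𝔉.SgpCapSpec) (hcup : 𝔉.SgpCupSpec) {actS actT : 𝔉.HB →* Aut 𝔉.BN}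
    (hS : ∀ h : 𝔉.HB, 𝔉.sCap ≫ (actS h).hom =
      (𝔉.strv (𝔉.autBaseIsoAB.symm (h : Aut (𝔉.base.obj 𝔉.BN)))).hom ≫ 𝔉.sCap)
    (hT : ∀ h : 𝔉.HB, 𝔉.sCup ≫ (actT h).hom =
      (𝔉.strv (𝔉.autBaseIsoAB.symm (h : Aut (𝔉.base.obj 𝔉.BN)))).hom ≫ 𝔉.sCup) :
    ThetaPairActionsAgree 𝔉 actS actT := by
  rw [thetaPairActionsAgree_iff]
  refine ⟨fun h => Aut.ext ?_, fun h => Aut.ext ?_⟩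
  · exact (cancel_epi 𝔉.sCap).mp ((hS h).trans (hcap _).symm)
  · exact (cancel_epi 𝔉.sCup).mp ((hT h).trans (hcup h).symm)

/-- Converse: if `ThetaPairActionsAgree` holds, the supplied actions satisfy the printed defining relations of
`s^⊓-gp_N|_{H_{B_N}}`, `s^⊔-gp_N` (F-0552/F-0553).  [cite: MochizukiEtTh2009, Prop 5.2 (ii) p.324 (PDF p.98)] -/
theorem definingRelations_of_thetaPairActionsAgree (hcap : 𝔉.SgpCapSpec) (hcup : 𝔉.SgpCupSpec)
    {actS actT : 𝔉.HB →* Aut 𝔉.BN} (h : ThetaPairActionsAgree 𝔉 actS actT) :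
    (∀ x : 𝔉.HB, 𝔉.sCap ≫ (actS x).hom =
        (𝔉.strv (𝔉.autBaseIsoAB.symm (x : Aut (𝔉.base.obj 𝔉.BN)))).hom ≫ 𝔉.sCap) ∧
      ∀ x : 𝔉.HB, 𝔉.sCup ≫ (actT x).hom =
        (𝔉.strv (𝔉.autBaseIsoAB.symm (x : Aut (𝔉.base.obj 𝔉.BN)))).hom ≫ 𝔉.sCup := by
  rw [thetaPairActionsAgree_iff] at h
  exact ⟨fun x => by rw [h.1 x]; exact hcap _, fun x => by rw [h.2 x]; exact hcup x⟩

/-- **F-0556 ⟺ the defining relations** (over epimorphisms `s^⊓_N`, `s^⊔_N` and given F-0552/F-0553): the typed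
Prop. 5.2 (ii) holds for the supplied §1 actions IFF they satisfy the two printed defining relations.
[cite: MochizukiEtTh2009, Prop 5.2 (ii) p.324 (PDF p.98)] -/
theorem thetaPairActionsAgree_iff_definingRelations [Epi 𝔉.sCap] [Epi 𝔉.sCup]
    (hcap : 𝔉.SgpCapSpec) (hcup : 𝔉.SgpCupSpec) (actS actT : 𝔉.HB →* Aut 𝔉.BN) :
    ThetaPairActionsAgree 𝔉 actS actT ↔
      (∀ x : 𝔉.HB, 𝔉.sCap ≫ (actS x).hom =
          (𝔉.strv (𝔉.autBaseIsoAB.symm (x : Aut (𝔉.base.obj 𝔉.BN)))).hom ≫ 𝔉.sCap) ∧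
        ∀ x : 𝔉.HB, 𝔉.sCup ≫ (actT x).hom =
          (𝔉.strv (𝔉.autBaseIsoAB.symm (x : Aut (𝔉.base.obj 𝔉.BN)))).hom ≫ 𝔉.sCup :=
  ⟨definingRelations_of_thetaPairActionsAgree 𝔉 hcap hcup,
    fun h => thetaPairActionsAgree_of_definingRelations 𝔉 hcap hcup h.1 h.2⟩

/-- At most one pair of actions satisfies `ThetaPairActionsAgree` (it names them).
[cite: MochizukiEtTh2009, Prop 5.2 (ii) p.324 (PDF p.98)] -/
theorem ThetaPairActionsAgree.unique {a b a' b' : 𝔉.HB →* Aut 𝔉.BN}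
    (h : ThetaPairActionsAgree 𝔉 a b) (h' : ThetaPairActionsAgree 𝔉 a' b') : a = a' ∧ b = b' :=
  ⟨h.1.trans h'.1.symm, h.2.trans h'.2.symm⟩

/-- Under F-0556 and F-0551 (Prop. 4.3 (iii)), the two supplied §1 actions differ by `μ_N(B_N)`:
`actS(h) · actT(h)⁻¹ ∈ μ_N(B_N)` for `h ∈ H_{B_N}`.  [cite: MochizukiEtTh2009, Prop 5.2 (ii) p.324 (PDF p.98)] -/
theorem ThetaPairActionsAgree.mul_inv_mem_muTorsion {actS actT : 𝔉.HB →* Aut 𝔉.BN}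
    (h : ThetaPairActionsAgree 𝔉 actS actT) (hd : 𝔉.BiKummerDifferenceMem) (x : 𝔉.HB) :
    actS x * (actT x)⁻¹ ∈ 𝔉.muTorsion 𝔉.BN 𝔉.N := by
  rw [thetaPairActionsAgree_iff] at h
  rw [h.1 x, h.2 x]
  exact (𝔉.biKummerDifferenceMem_iff.mp hd) x

/-- Under F-0556 and the section property of `s^⊓-gp_N` (`SgpCapSection`, PROVED from F-0552 + F-0555 by
abc-iut-L2-t4's `sgpCapSection_of`), the first §1 action lifts `H_{B_N}`: `(actS h)^bs = h`.
[cite: MochizukiEtTh2009, Prop 5.2 (ii) p.324 (PDF p.98)] -/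
theorem ThetaPairActionsAgree.autBase_apply {actS actT : 𝔉.HB →* Aut 𝔉.BN}
    (h : ThetaPairActionsAgree 𝔉 actS actT) (hsec : 𝔉.SgpCapSection) (x : 𝔉.HB) :
    𝔉.autBase 𝔉.BN (actS x) = x := by
  rw [thetaPairActionsAgree_iff] at h
  rw [h.1 x]
  exact hsec x

/-! ### F-0558 `ThetaPairKummerClass` (Prop. 5.2 (iii)) -/

/-- The pointwise criterion (witness `u := 1`): if the bi-Kummer difference cocycle `s^⊓-gp_N · (s^⊔-gp_N)⁻¹`
EQUALS `ν ∘ η` on `H_{B_N}`, then `ThetaPairKummerClass 𝔉 η ν`.  FACT-LIST F-0558.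
[cite: MochizukiEtTh2009, Prop 5.2 (iii) p.324 (PDF p.98)] -/
theorem thetaPairKummerClass_of_forall_eq {η : 𝔉.HB → 𝔉.lDeltaModN 𝔉.BN}
    {ν : 𝔉.lDeltaModN 𝔉.BN ≃* 𝔉.muTorsion 𝔉.BN 𝔉.N}
    (h : ∀ x : 𝔉.HB,
      𝔉.sgpCap (x : Aut (𝔉.base.obj 𝔉.BN)) * (𝔉.sgpCup x)⁻¹ = (ν (η x) : Aut 𝔉.BN)) :
    ThetaPairKummerClass 𝔉 η ν :=
  ⟨1, one_mem _, fun x => by rw [h x, mul_one, inv_one, mul_one, mul_inv_cancel, one_mul]⟩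

/-- **F-0558 from F-0551 (Prop. 4.3 (iii)), for EVERY comparison `ν`**: the tautological cocycle
`η := ν⁻¹ ∘ (s^⊓-gp_N · (s^⊔-gp_N)⁻¹)` (well defined because the difference is `μ_N(B_N)`-valued, abc-iut-L2-t4's
`biKummerDifferenceMem_iff`) satisfies `ThetaPairKummerClass 𝔉 η ν` with `u := 1`.
[cite: MochizukiEtTh2009, Prop 5.2 (iii) p.324 (PDF p.98)] -/
theorem thetaPairKummerClass_of_biKummerDifferenceMem (hd : 𝔉.BiKummerDifferenceMem)
    (ν : 𝔉.lDeltaModN 𝔉.BN ≃* 𝔉.muTorsion 𝔉.BN 𝔉.N) :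
    ThetaPairKummerClass 𝔉
      (fun h => ν.symm ⟨𝔉.sgpCap (h : Aut (𝔉.base.obj 𝔉.BN)) * (𝔉.sgpCup h)⁻¹,
        (𝔉.biKummerDifferenceMem_iff.mp hd) h⟩) ν :=
  thetaPairKummerClass_of_forall_eq 𝔉 fun x => by rw [MulEquiv.apply_symm_apply]

/-- **The `η`-existential content of F-0558 is exactly F-0551**: for every comparison `ν`,
`(∃ η, ThetaPairKummerClass 𝔉 η ν) ↔ BiKummerDifferenceMem 𝔉`.  (`→`: abc-iut-L2-t11's
`biKummerDifferenceMem_of_thetaPairKummerClass`, `Discharge/Sec5RigidityGlue.lean`, re-proved here — `μ_N(B_N)` is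
normal in `Aut_C(B_N)`; `←`: `thetaPairKummerClass_of_biKummerDifferenceMem`.)  The remaining content of
Prop. 5.2 (iii) — WHICH `η` ("the reduction modulo `N` of the class `η̲̈^Θ`") — is a parameter of the typed row.
[cite: MochizukiEtTh2009, Prop 5.2 (iii) p.324 (PDF p.98)] -/
theorem exists_thetaPairKummerClass_iff (ν : 𝔉.lDeltaModN 𝔉.BN ≃* 𝔉.muTorsion 𝔉.BN 𝔉.N) :
    (∃ η : 𝔉.HB → 𝔉.lDeltaModN 𝔉.BN, ThetaPairKummerClass 𝔉 η ν) ↔ 𝔉.BiKummerDifferenceMem := by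
  constructor
  · rintro ⟨η, u, hu, hall⟩
    rw [ThetaFrobenioid.biKummerDifferenceMem_iff]
    intro h
    rw [hall h]
    exact mul_mem (mul_mem ((𝔉.muTorsion_normal 𝔉.BN 𝔉.N).conj_mem u hu _) (inv_mem hu)) (ν (η h)).2
  · exact fun hd => ⟨_, thetaPairKummerClass_of_biKummerDifferenceMem 𝔉 hd ν⟩

/-- When `H_{B_N}` centralises `μ_N(B_N)` through `s^⊓-gp_N` (e.g. trivial cyclotomic character mod `N`), the
coboundary term of `ThetaPairKummerClass` vanishes and the row is the POINTWISE identity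
`s^⊓-gp_N(h) · s^⊔-gp_N(h)⁻¹ = ν(η(h))`.  [cite: MochizukiEtTh2009, Prop 5.2 (iii) p.324 (PDF p.98)] -/
theorem thetaPairKummerClass_iff_forall_eq_of_comm
    (hc : ∀ (x : 𝔉.HB) (u : Aut 𝔉.BN), u ∈ 𝔉.muTorsion 𝔉.BN 𝔉.N →
      𝔉.sgpCap (x : Aut (𝔉.base.obj 𝔉.BN)) * u = u * 𝔉.sgpCap (x : Aut (𝔉.base.obj 𝔉.BN)))
    (η : 𝔉.HB → 𝔉.lDeltaModN 𝔉.BN) (ν : 𝔉.lDeltaModN 𝔉.BN ≃* 𝔉.muTorsion 𝔉.BN 𝔉.N) :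
    ThetaPairKummerClass 𝔉 η ν ↔
      ∀ x : 𝔉.HB,
        𝔉.sgpCap (x : Aut (𝔉.base.obj 𝔉.BN)) * (𝔉.sgpCup x)⁻¹ = (ν (η x) : Aut 𝔉.BN) := by
  refine ⟨?_, thetaPairKummerClass_of_forall_eq 𝔉⟩
  rintro ⟨u, hu, hall⟩ x
  rw [hall x, hc x u hu, mul_inv_cancel_right, mul_inv_cancel, one_mul]

/-- Changing the identification of `(l·Δ_Θ)_{B_N} ⊗ ℤ/Nℤ` by an automorphism `e` is absorbed into the cocycle:
`ThetaPairKummerClass (e ∘ η) ν ↔ ThetaPairKummerClass η (ν ∘ e)` ("relative to the natural isomorphism").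
[cite: MochizukiEtTh2009, Prop 5.2 (iii) p.324 (PDF p.98)] -/
theorem thetaPairKummerClass_comp_iff (e : 𝔉.lDeltaModN 𝔉.BN ≃* 𝔉.lDeltaModN 𝔉.BN)
    (η : 𝔉.HB → 𝔉.lDeltaModN 𝔉.BN) (ν : 𝔉.lDeltaModN 𝔉.BN ≃* 𝔉.muTorsion 𝔉.BN 𝔉.N) :
    ThetaPairKummerClass 𝔉 (e ∘ η) ν ↔ ThetaPairKummerClass 𝔉 η (e.trans ν) :=
  Iff.rfl

end FrobenioidThetaBiKummer

end Literature.AnabelianGeometry.EtaleTheta
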